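import Literature.MathematicalPhysics.QuantumLattice.InfiniteVolumeProofs
import HarnessLib

/-!
# State inequalities for the twist argument: Cauchy–Schwarz, near-eigenvectors, the energy of a
# local unitary, and the gap inequality for unitaries

Trunk **T-QLATTICE**. Proof file behind the named fact
`Literature.MathematicalPhysics.QuantumLattice.no_unique_gapped_groundState_halfOddSpin`
(`InfiniteVolume.lean`). It records, for an infinite-volume state `ω : InfVolState d q` (a
compatible family of states `ω_Λ` on the local algebras `𝔄_Λ = Op ↥Λ q`, `InfiniteVolumeStates`),
the four elementary inequalities through which a (gapped) ground state enters the
Lieb–Schultz–Mattis / Affleck–Lieb twist argument in the form of Tasaki (2022) §3.1: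

* `InfVolState.norm_expect_conjTranspose_mul_le` — the **Cauchy–Schwarz inequality**
  `|ω(Bᴴ C)| ≤ ω(BᴴB)^{1/2} ω(CᴴC)^{1/2}` (Bratteli–Robinson I, Lemma 2.3.10(b); here through
  Mathlib's pre-GNS semi-inner product `⟪B, C⟫ = ω(BᴴC)`, `PositiveLinearMap.PreGNS`);
* `InfVolState.norm_expect_conjTranspose_mul_sub_le` — the **near-eigenvector estimate**
  `|ω(Uᴴ V) - conj(ω U) ω(V)| ≤ (ω(UᴴU) - |ω(U)|²)^{1/2} ω(VᴴV)^{1/2}` (Cauchy–Schwarz applied to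
  `U - ω(U)𝟙`; in the GNS language `‖π(U)Ω - ω(U)Ω‖² = ω(UᴴU) - |ω(U)|²`, the quantity controlled
  by the gap in Tasaki 2022, Lemma 3.2);
* `InfVolState.neg_I_mul_expect_derivation_unitary` — **the energy of a local unitary**: for a
  finite-range interaction, a unitary `U ∈ 𝔄_Λ` and any region `Λ' ⊇ Λ_R`,
  `-i ω(Uᴴ δ(U)) = ω(Uᴴ H_{Λ'} U - H_{Λ'})` (Tasaki 2022, after Lemma 3.1:
  `ω(Uᴴ[H,U]) = ⟨Ψ|H|Ψ⟩ - E_GS`, "the increase in the energy expectation value when the ground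
  state is modified by a local unitary");
* `InfVolState.IsGroundState.re_expect_unitary_nonneg` and
  `InfVolState.IsGappedGroundState.gap_mul_le_re_expect_unitary` — for a ground state this energy
  is `≥ 0` (Tasaki 2022, eq. (2.5)/first inequality of (3.5)), and for a gapped ground state
  `γ (1 - |ω(U)|²) ≤ ω(Uᴴ H U - H)` (Tasaki 2022, proof of Lemma 3.2, eq. (3.11)).

No statement of any other file is changed and no definition is introduced; the file imports
`InfiniteVolumeProofs.lean` (for `embedOp_one`, isotony is unital) and through it the
ground-state proof files of `InfiniteVolumeStates` (`embedOp_derivation`, the algebra of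
`embedOp`, `InfVolState.expect_conjTranspose_holds`, `InfVolState.expect_nonneg_of_nonneg`).

## References

* H. Tasaki, *The Lieb–Schultz–Mattis theorem. A topological point of view*, in: The Physics
  and Mathematics of Elliott Lieb, vol. 2, EMS Press (2022) 405–446, arXiv:2202.06243 (held),
  Def. 2.2, §3.1 Lemma 3.1 and Lemma 3.2 with eqs. (3.5), (3.10), (3.11). [Tasaki2022]
* O. Bratteli, D. W. Robinson, *Operator Algebras and Quantum Statistical Mechanics 1*
  (2nd ed., Springer 1987), Lemma 2.3.10(b) (Cauchy–Schwarz for positive functionals).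
  [BratteliRobinsonI1987]
-/

noncomputable section

open Matrix Complex Finset
open scoped ComplexOrder

namespace Literature.MathematicalPhysics.QuantumLattice

open Literature.Probability.LatticeModels
open Literature.Probability.LatticeModels (Site)

variable {d q : ℕ}

namespace InfVolState

variable (ω : InfVolState d q)

/-! ### Cauchy–Schwarz -/

open scoped MatrixOrder Matrix.Norms.L2Operator InnerProductSpace in
/-- **Cauchy–Schwarz inequality for the local states**: `|ω_Λ(Bᴴ C)| ≤ ω_Λ(BᴴB)^{1/2} ω_Λ(CᴴC)^{1/2}`
(real parts under the square roots; both expectations are `≥ 0`). Bratteli–Robinson I,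
Lemma 2.3.10(b); used throughout Tasaki (2022) §3 ("the Schwarz inequality"). Here it is
`norm_inner_le_norm` in Mathlib's pre-GNS space of the positive functional `ω_Λ` on the
C⋆-algebra `𝔄_Λ` (semi-inner product `⟪B, C⟫ = ω_Λ(BᴴC)`, norm `‖B‖ = (re ω_Λ(BᴴB))^{1/2}`).
[cite: BratteliRobinsonI1987, Lemma 2.3.10(b)] -/
theorem norm_expect_conjTranspose_mul_le (Λ : Finset (Site d)) (B C : Op ↥Λ q) :
    ‖ω.expect Λ (Bᴴ * C)‖ ≤
      √(ω.expect Λ (Bᴴ * B)).re * √(ω.expect Λ (Cᴴ * C)).re := by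
  letI : CStarAlgebra (Op ↥Λ q) := {}
  set f : Op ↥Λ q →ₚ[ℂ] ℂ := .mk₀ (ω.expect Λ) fun _ hB => ω.expect_nonneg_of_nonneg Λ hB
    with hf
  have key : ∀ x, f x = ω.expect Λ x := fun x => rfl
  have hcs := norm_inner_le_norm (𝕜 := ℂ) (f.toPreGNS B) (f.toPreGNS C)
  rw [PositiveLinearMap.preGNS_inner_def, PositiveLinearMap.preGNS_norm_def,
    PositiveLinearMap.preGNS_norm_def] at hcs
  simp only [PositiveLinearMap.ofPreGNS_toPreGNS, key, star_eq_conjTranspose] at hcs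
  exact hcs

/-- **Near-eigenvector estimate**: `|ω_Λ(Uᴴ V) - conj(ω_Λ U) ω_Λ(V)| ≤ (ω_Λ(UᴴU) - |ω_Λ U|²)^{1/2} ω_Λ(VᴴV)^{1/2}`,
Cauchy–Schwarz applied to `U - ω(U)𝟙` and `V` (using `ω(Uᴴ) = conj ω(U)` and `ω(𝟙) = 1`). In
the GNS picture `ω(UᴴU) - |ω(U)|² = ‖π(U)Ω - ω(U)Ω‖²`, the deviation of `π(U)Ω` from the vacuum
ray, which the gap inequality makes small (Tasaki 2022, proof of Lemma 3.2).
[cite: Tasaki2022, §3.1 Lemma 3.2 (proof)] -/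
theorem norm_expect_conjTranspose_mul_sub_le (Λ : Finset (Site d)) (U V : Op ↥Λ q) :
    ‖ω.expect Λ (Uᴴ * V) - (starRingEnd ℂ) (ω.expect Λ U) * ω.expect Λ V‖ ≤
      √((ω.expect Λ (Uᴴ * U)).re - ‖ω.expect Λ U‖ ^ 2) * √(ω.expect Λ (Vᴴ * V)).re := by
  set c := ω.expect Λ U with hc
  have hU : ω.expect Λ Uᴴ = (starRingEnd ℂ) c := ω.expect_conjTranspose_holds Λ U
  have h := ω.norm_expect_conjTranspose_mul_le Λ (U - c • (1 : Op ↥Λ q)) V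
  have h1 : ω.expect Λ ((U - c • (1 : Op ↥Λ q))ᴴ * V) =
      ω.expect Λ (Uᴴ * V) - (starRingEnd ℂ) c * ω.expect Λ V := by
    rw [conjTranspose_sub, conjTranspose_smul, conjTranspose_one, sub_mul, smul_mul_assoc,
      one_mul, map_sub, map_smul, smul_eq_mul, Complex.star_def]
  have h2 : (ω.expect Λ ((U - c • (1 : Op ↥Λ q))ᴴ * (U - c • (1 : Op ↥Λ q)))).re =
      (ω.expect Λ (Uᴴ * U)).re - ‖c‖ ^ 2 := by
    rw [conjTranspose_sub, conjTranspose_smul, conjTranspose_one, sub_mul, mul_sub, mul_sub,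
      smul_mul_assoc, one_mul, mul_smul_comm, mul_one, smul_mul_assoc, one_mul, smul_smul,
      map_sub, map_sub, map_sub, map_smul, map_smul, map_smul, hU, ω.expect_one,
      Complex.star_def, smul_eq_mul, smul_eq_mul, smul_eq_mul, mul_one]
    simp only [Complex.sub_re, Complex.mul_re, Complex.conj_re, Complex.conj_im]
    rw [Complex.sq_norm, Complex.normSq_apply]
    ring
  rw [h1, h2] at h
  exact h

/-! ### The energy of a local unitary -/

variable {ω}

/-- **The energy of a local unitary.** For an interaction `Φ` of finite range `R`, a unitary
`U ∈ 𝔄_Λ` (`UᴴU = 𝟙`) and any finite region `Λ' ⊇ Λ_R = thicken Λ R`, the ground-state functional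
evaluates to an energy difference: `-i ω(Uᴴ δ(U)) = ω_{Λ'}(Ũᴴ H_{Λ'} Ũ - H_{Λ'})`, `Ũ = U ⊗ 𝟙`,
`H_{Λ'} = Σ_{X ⊆ Λ'} Φ X` (by locality of the generator, `embedOp_derivation`:
`δ(U) ⊗ 𝟙 = i[H_{Λ'}, Ũ]`, and `ŨᴴŨ = 𝟙`). This is "the increase in the energy expectation value
when the state is modified by a local unitary" (Tasaki 2022, §3.1, discussion after Lemma 3.1:
`ω(Ûᴴ[Ĥ,Û]) = ⟨Ψ|Ĥ|Ψ⟩ - E_GS`). [cite: Tasaki2022, §3.1 Lemma 3.1 (discussion)] -/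
theorem neg_I_mul_expect_derivation_unitary {Φ : LatticeInteraction d q} {R : ℝ}
    (hΦ : Φ.HasFiniteRange R) {Λ : Finset (Site d)} {U : Op ↥Λ q} (hU : Uᴴ * U = 1)
    {Λ' : Finset (Site d)} (hT : thicken Λ R ⊆ Λ') :
    -I * ω.expect (thicken Λ R) ((embedOp (subset_thicken Λ R) U)ᴴ * derivation Φ R Λ U) =
      ω.expect Λ'
        ((embedOp ((subset_thicken Λ R).trans hT) U)ᴴ * localHamiltonian (Φ.restrict Λ') univ *
            embedOp ((subset_thicken Λ R).trans hT) U -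
          localHamiltonian (Φ.restrict Λ') univ) := by
  set Ũ := embedOp ((subset_thicken Λ R).trans hT) U with hŨ
  set H := localHamiltonian (Φ.restrict Λ') univ with hH
  have hŨU : Ũᴴ * Ũ = 1 := by
    rw [hŨ, ← embedOp_conjTranspose, ← embedOp_mul, hU, embedOp_one]
  rw [← ω.compatible hT, embedOp_mul, embedOp_conjTranspose, embedOp_embedOp,
    embedOp_derivation hΦ Λ U hT, ← hŨ, ← hH, Matrix.mul_smul, map_smul, smul_eq_mul, ← mul_assoc,
    show -I * I = 1 by rw [neg_mul, Complex.I_mul_I, neg_neg], one_mul, Matrix.mul_sub,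
    ← Matrix.mul_assoc, ← Matrix.mul_assoc, hŨU, Matrix.one_mul]

/-- **A ground state cannot lower its energy by a local unitary**: `0 ≤ ω_{Λ'}(Ũᴴ H_{Λ'} Ũ - H_{Λ'})`
(real part; the expectation is real) for every unitary `U ∈ 𝔄_Λ` and `Λ' ⊇ Λ_R` — the
ground-state inequality `ω(Uᴴ[H,U]) ≥ 0` (Tasaki 2022, Def. 2.2, eq. (2.5); first inequality of
Lemma 3.1, eq. (3.5)) combined with `neg_I_mul_expect_derivation_unitary`.
[cite: Tasaki2022, Def. 2.2 / Lemma 3.1 eq. (3.5)] -/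
theorem IsGroundState.re_expect_unitary_nonneg {Φ : LatticeInteraction d q} {R : ℝ}
    (hω : ω.IsGroundState Φ R) (hΦ : Φ.HasFiniteRange R) {Λ : Finset (Site d)} {U : Op ↥Λ q}
    (hU : Uᴴ * U = 1) {Λ' : Finset (Site d)} (hT : thicken Λ R ⊆ Λ') :
    0 ≤ (ω.expect Λ'
        ((embedOp ((subset_thicken Λ R).trans hT) U)ᴴ * localHamiltonian (Φ.restrict Λ') univ *
            embedOp ((subset_thicken Λ R).trans hT) U -
          localHamiltonian (Φ.restrict Λ') univ)).re := by
  have h := hω Λ U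
  rw [neg_I_mul_expect_derivation_unitary hΦ hU hT, Complex.nonneg_iff] at h
  exact h.1

/-- The energy of a local unitary in a ground state is real:
`im ω_{Λ'}(Ũᴴ H_{Λ'} Ũ - H_{Λ'}) = 0`. Tasaki (2022) Def. 2.2 (the quantity in eq. (2.5) is real).
[cite: Tasaki2022, Def. 2.2] -/
theorem IsGroundState.im_expect_unitary_eq_zero {Φ : LatticeInteraction d q} {R : ℝ}
    (hω : ω.IsGroundState Φ R) (hΦ : Φ.HasFiniteRange R) {Λ : Finset (Site d)} {U : Op ↥Λ q}
    (hU : Uᴴ * U = 1) {Λ' : Finset (Site d)} (hT : thicken Λ R ⊆ Λ') :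
    (ω.expect Λ'
        ((embedOp ((subset_thicken Λ R).trans hT) U)ᴴ * localHamiltonian (Φ.restrict Λ') univ *
            embedOp ((subset_thicken Λ R).trans hT) U -
          localHamiltonian (Φ.restrict Λ') univ)).im = 0 := by
  have h := hω Λ U
  rw [neg_I_mul_expect_derivation_unitary hΦ hU hT, Complex.nonneg_iff] at h
  exact h.2.symm

/-- **The gap inequality for a local unitary**: if `ω` is a gapped ground state with gap `γ`, then
for every unitary `U ∈ 𝔄_Λ` and `Λ' ⊇ Λ_R`,
`γ (1 - |ω(U)|²) ≤ ω_{Λ'}(Ũᴴ H_{Λ'} Ũ - H_{Λ'})` — the local gap criterion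
`γ(ω(AᴴA) - |ω(A)|²) ≤ -iω(Aᴴδ(A))` at `A = U` with `ω(UᴴU) = 1`. This is eq. (3.11) in the proof
of Tasaki (2022), Lemma 3.2 (`ω(Ûᴴ[Ĥ,Û]) ≥ ΔE (1 - |ω(Û)|²)`). [cite: Tasaki2022, Lemma 3.2 eq. (3.11)] -/
theorem IsGappedGroundState.gap_mul_le_re_expect_unitary {Φ : LatticeInteraction d q} {R γ : ℝ}
    (hω : ω.IsGappedGroundState Φ R γ) (hΦ : Φ.HasFiniteRange R) {Λ : Finset (Site d)}
    {U : Op ↥Λ q} (hU : Uᴴ * U = 1) {Λ' : Finset (Site d)} (hT : thicken Λ R ⊆ Λ') :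
    γ * (1 - ‖ω.expect Λ U‖ ^ 2) ≤ (ω.expect Λ'
        ((embedOp ((subset_thicken Λ R).trans hT) U)ᴴ * localHamiltonian (Φ.restrict Λ') univ *
            embedOp ((subset_thicken Λ R).trans hT) U -
          localHamiltonian (Φ.restrict Λ') univ)).re := by
  have h := hω.2.2 Λ U
  rw [neg_I_mul_expect_derivation_unitary hΦ hU hT, hU, ω.expect_one, Complex.one_re,
    Complex.le_def, Complex.ofReal_re] at h
  exact h.1

end InfVolState

end Literature.MathematicalPhysics.QuantumLattice
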